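import Literature.NumberTheory.EllipticCurves.BSDSelmerPConverseYanZhuKolyvaginSystemProofs
import Literature.NumberTheory.EllipticCurves.HeegnerPointsOfConductorOneGaloisConjProofs
import Literature.NumberTheory.EllipticCurves.BSDHeegnerPointsGrossZagierProofs
import Literature.NumberTheory.EllipticCurves.LFunctionSmulProofs
import Literature.NumberTheory.EllipticCurves.BSDInvariantsProofs
import Literature.NumberTheory.EllipticCurves.QuadraticTwistRank
import HarnessLib

/-!
# Route `CMKolyvaginAtInertTwo`, crux `CMKolyvaginExactAtInertTwo` (stmt-BirchSwinnertonDyer-24277):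
# THE COUNT IDENTITY, VIII — total rank one and finiteness of `Ш(E/ℚ)`, `Ш(E^{(d_K)}/ℚ)` from the
# crux's Heegner datum (`y_K = P(1)` of infinite order), modulo Gross–Zagier, GZK and modularity

Seat `bsd-line-cmk2-p1` g15 (cell `bsd-print-cf2`); helper (`--supports stmt-BirchSwinnertonDyer-24277`).
THEOREMS ONLY: no definition, no named fact, no `sorry`; the route's published inputs
`gross_zagier` (all levels, item 24148), `rank_eq_analyticRank_of_analyticRank_le_one` (GZK, item
19921) and `hasEntireLFunction_rat` (item 19273) are HYPOTHESES; no item is closed; BSD is not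
proved by this.

The count identity (files IV–VII) takes `rank E(ℚ) + rank Wd(ℚ) = 1` and the finiteness of
`Ш(E/ℚ)`, `Ш(Wd/ℚ)`. The crux supplies them through its Heegner datum: `d₁.derivedPoint = P(1)` of
infinite order lies below a Heegner point `P₀ ∈ E(K)`
(`heegnerSystem_exists_isHeegnerPoint_map_eq_derivedPoint_one`, Shimura reciprocity at conductor `1`), so `L'(E/K,1) ≠ 0` (Gross–Zagier,
`lDerivEK_ne_zero_iff_not_isOfFinAddOrder`), hence `ord_{s=1} L(E/K,s) ≤ 1`; it is not `0`, for
then `r_an(E) = r_an(E^{(d_K)}) = 0` (additivity under modularity), GZK would make `E(K)` of rank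
`0 = rank E(ℚ) + rank E^{(d_K)}(ℚ)`, against the point `P₀`. So `r_an(E) + r_an(E^{(d_K)}) = 1`,
both `≤ 1`, and GZK gives the ranks and the finiteness. NO root-number / sign input is used.

* `analyticRankEK_le_one_of_lDerivEK_ne_zero` — `L'(E/K,1) ≠ 0 ⟹ ord_{s=1} L(E/K,s) ≤ 1`;
* `rank_add_eq_one_and_finite_sha_of_heegnerData_of_facts` — **`rank W + rank Wd = 1 ∧
  Finite Ш(W) ∧ Finite Ш(Wd)`** from the crux's binders (`W`, `K`, `Dt`, `d₁`, `y_K` non-torsion)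
  and a model `Wd ≅ W^{(d_K)}`, modulo GZ, GZK, modularity.

References: Gross–Zagier 1986 I.(6.3), V.§2; Gross 1991 (1.1), Thm. 1.3; Kolyvagin 1990.
-/

-- single-conjunct summit: `Summit.BirchSwinnertonDyer.BirchSwinnertonDyer.…` repeats the name by design
set_option linter.dupNamespace false
set_option autoImplicit false

noncomputable section

open scoped Classical

open WeierstrassCurve NumberField Literature.NumberTheory.EllipticCurves
  Literature.NumberTheory.EllipticCurves.ModularForms Literature.NumberTheory.QuadraticFields

namespace Summit.BirchSwinnertonDyer.BirchSwinnertonDyer.Theorems.ShaCountTwo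

/-- **`L'(E/K,1) ≠ 0 ⟹ ord_{s=1} L(E/K,s) ≤ 1`**: `LDerivEK` is the derivative at `1` of the
function whose order at `1` is `analyticRankEK`; an analytic germ of order `≥ 2` has vanishing
first derivative (the tree's `analyticOrderNatAt_eq_one_iff_deriv_ne_zero` in order `≥ 1`; order
`0` is `≤ 1` trivially). [cite: GrossZagier1986, I.§7] -/
theorem analyticRankEK_le_one_of_lDerivEK_ne_zero (W : WeierstrassCurve ℚ) (K : Type) [Field K]
    [NumberField K] (h : LDerivEK W K ≠ 0) : analyticRankEK W K ≤ 1 := by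
  by_cases h1 : 1 ≤ analyticRankEK W K
  · exact ((analyticOrderNatAt_eq_one_iff_deriv_ne_zero h1).mpr h).le
  · omega

/-- **TOTAL RANK ONE AND FINITENESS FROM THE CRUX'S HEEGNER DATUM** (modulo Gross–Zagier at all
levels, GZK, modularity). `W/ℚ` globally minimal of conductor `N`; `K` imaginary quadratic
satisfying the Heegner hypothesis for `N`; `Dt` a parametrisation datum, `d₁` Kolyvagin–Heegner data
of conductor `1` with `P(1) = d₁.derivedPoint` of infinite order; `Wd` any `ℚ`-model of `W^{(d_K)}`.
THEN `rank W(ℚ) + rank Wd(ℚ) = 1`, and `Ш(W/ℚ)`, `Ш(Wd/ℚ)` are finite. See the module docstring.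
[cite: GrossZagier1986, Thm. I.(6.3) with V.§2] [cite: GrossLMS1991, (1.1) and Thm. 1.3] -/
theorem rank_add_eq_one_and_finite_sha_of_heegnerData_of_facts
    (hGZ : ∀ (N : ℕ) [NeZero N] (W : WeierstrassCurve ℚ) (K : Type) [Field K] [NumberField K],
      gross_zagier N W K)
    (hGZK : rank_eq_analyticRank_of_analyticRank_le_one) (hmod : hasEntireLFunction_rat)
    (W : WeierstrassCurve ℚ) [W.IsElliptic] [W.IsGloballyMinimal] [NeZero (W.conductorNorm ℤ)]
    (K : Type) [Field K] [NumberField K] (hK : IsImaginaryQuadratic K)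
    (hH : SatisfiesHeegnerHypothesis (W.conductorNorm ℤ) K)
    (Dt : ModularParametrizationData W (W.conductorNorm ℤ)) (β : ℤ) (ι : K →+* ℂ)
    (d₁ : KolyvaginHeegnerData Dt β ι 1) (hy : ¬ IsOfFinAddOrder d₁.derivedPoint)
    (Wd : WeierstrassCurve ℚ) [Wd.IsElliptic]
    (hWd : ∃ C : VariableChange ℚ, C • W.quadraticTwist (NumberField.discr K : ℚ) = Wd) :
    W.mordellWeilRank + Wd.mordellWeilRank = 1 ∧ Finite W.sha ∧ Finite Wd.sha := by
  haveI hEK : (W.baseChange K).IsElliptic := by rw [baseChange]; infer_instance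
  have h2 : Module.finrank ℚ K = 2 := hK.1
  have hD0 : (NumberField.discr K : ℚ) ≠ 0 := by exact_mod_cast NumberField.discr_ne_zero K
  haveI hEt : (W.quadraticTwist (NumberField.discr K : ℚ)).IsElliptic := W.isElliptic_quadraticTwist hD0
  obtain ⟨Cd, hCd⟩ := hWd
  -- the Heegner point `P₀ ∈ E(K)` below `P(1)`
  obtain ⟨P₀, hP₀, hP₀K⟩ := heegnerSystem_exists_isHeegnerPoint_map_eq_derivedPoint_one
    (heegnerPointOfConductor_one_galoisConj_holds (W.conductorNorm ℤ) W K) hK hH d₁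
  have hPinf : ¬ IsOfFinAddOrder P₀ := by
    intro hfin
    apply hy
    rw [← hP₀K]
    exact (WeierstrassCurve.Affine.Point.map (W' := W)
      (algebraMap K (ringClassField K ι 1)).toRatAlgHom).isOfFinAddOrder hfin
  -- Gross–Zagier: `L'(E/K,1) ≠ 0`, so `ord ≤ 1`
  have hLK : LDerivEK W K ≠ 0 :=
    (lDerivEK_ne_zero_iff_not_isOfFinAddOrder W (W.conductorNorm ℤ) K (hGZ _ W K) hK hH hP₀).mpr hPinf
  have hle : analyticRankEK W K ≤ 1 := analyticRankEK_le_one_of_lDerivEK_ne_zero W K hLK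
  have hadd : analyticRankEK W K =
      W.analyticRank + (W.quadraticTwist (NumberField.discr K : ℚ)).analyticRank :=
    analyticRankEK_eq_add_of hmod W K
  -- ranks of the models
  have hrd : Wd.mordellWeilRank = (W.quadraticTwist (NumberField.discr K : ℚ)).mordellWeilRank := by
    rw [← hCd, mordellWeilRank_variableChange_holds]
  have hrad : Wd.analyticRank = (W.quadraticTwist (NumberField.discr K : ℚ)).analyticRank := by
    rw [← hCd, analyticRank_smul]
  have hrK : (W.baseChange K).mordellWeilRank =
      W.mordellWeilRank + (W.quadraticTwist (NumberField.discr K : ℚ)).mordellWeilRank := by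
    haveI : Module.Finite ℤ (W.baseChange K).toAffine.Point := (W.baseChange K).module_finite_point_holds
    exact W.mordellWeilRank_baseChange_of_finrank_eq_two_of_finite K h2
  have hpos : 1 ≤ (W.baseChange K).mordellWeilRank :=
    one_le_mordellWeilRank_of_not_isOfFinAddOrder (W.baseChange K)
      (W.baseChange K).module_finite_point_holds hPinf
  -- the two analytic ranks are `≤ 1`; GZK
  have hW1 : W.analyticRank ≤ 1 := by omega
  have ht1 : (W.quadraticTwist (NumberField.discr K : ℚ)).analyticRank ≤ 1 := by omega
  obtain ⟨hrW, hfinW⟩ := hGZK W hW1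
  obtain ⟨hrt, hfint⟩ := hGZK (W.quadraticTwist (NumberField.discr K : ℚ)) ht1
  have hWd1 : Wd.analyticRank ≤ 1 := by rw [hrad]; exact ht1
  obtain ⟨-, hfinD⟩ := hGZK Wd hWd1
  -- `ord ≠ 0`: otherwise `rank E(K) = 0` against `P₀`
  have hsum : W.analyticRank + (W.quadraticTwist (NumberField.discr K : ℚ)).analyticRank = 1 := by
    rcases Nat.lt_or_ge (analyticRankEK W K) 1 with h0 | h1
    · exfalso
      have h00 : analyticRankEK W K = 0 := by omega
      rw [hadd] at h00
      have hW0 : W.mordellWeilRank = 0 := by rw [hrW]; omega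
      have ht0 : (W.quadraticTwist (NumberField.discr K : ℚ)).mordellWeilRank = 0 := by rw [hrt]; omega
      rw [hrK, hW0, ht0] at hpos
      exact absurd hpos (by norm_num)
    · omega
  refine ⟨?_, hfinW, hfinD⟩
  rw [hrd, hrW, hrt]
  exact hsum

end Summit.BirchSwinnertonDyer.BirchSwinnertonDyer.Theorems.ShaCountTwo

end
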